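import Summits.ResolutionOfSingularities.ResolutionOfSingularities.Theorems.RadicialJungCleanModelsSufficeProdFreeMonoid

/-!
# Route `RadicialJung`, crux `CleanModelsSuffice`, line `Sketch`: the chart monoids are fs

Registered stub `stub_kummerMonoid` of the skeleton `Cruxes/CleanModelsSuffice/Lines/Sketch.lean`
(crux stmt-ResolutionOfSingularities-15883). The Kato charts of the line live on three kinds of
submonoids of `ℤⁿ`:

* the KUMMER MONOID `P_a = {c ∈ ℤ^{m+1} | 0 ≤ c₀, 0 ≤ a_i c₀ + p c_i (i ≠ 0)}` — the exponents
  `(c₀/p)·a + c` of the monomials `y^{c₀} ∏_{i≠0} t_i^{c_i}` in the `p`-th roots of the boundary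
  parameters, written in the basis `a/p, e₁, …, e_m` of the lattice `ℤ^{m+1} + ℤ·a/p` (`a₀ = 1`);
* its product `P_a × ℕ^{r'} ⊆ ℤ^{(m+1)+r'}` with a free monoid (the uncharged boundary
  parameters as extra coordinates);
* the free monoid `ℕ^{r'} ⊆ ℤ^{r'}` (charts at regular-type points).

All three are finitely generated, saturated (`AddSubmonoid.NSMulSaturated`) and span the ambient
lattice — the "fs, `Pᵍᵖ = ℤⁿ`" conditions of `LogAtlas` / `Kato1994_logRegularScheme_hasResolution`.
Generators of `P_a`: `v = (p, -a₁, …, -a_m)`, `w_j = (j, -⌊j a₁/p⌋, …, -⌊j a_m/p⌋)` (`j < p`) and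
the unit vectors: for `c ∈ P_a` with `c₀ = p q + j`, `0 ≤ j < p`,
`c = q·v + w_j + Σ_{i≠0} n_i e_i` with `n_i = c_i + q a_i + ⌊j a_i/p⌋ ≥ 0`.

Everything is stated for submonoids CHARACTERISED by their membership predicate (no new
definitions), as the registered signature is existential.
-/

set_option linter.dupNamespace false -- mandated namespace of this single-conjunct summit

namespace Summit.ResolutionOfSingularities.ResolutionOfSingularities.Theorems.RadicialJung.CleanModelsSuffice

open Finset

section FreeMonoid

variable {n : ℕ}

/-- **The free monoid `ℕⁿ ⊆ ℤⁿ` is finitely generated, saturated and spanning.** [folklore] -/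
theorem freeMonoid_fs (N : AddSubmonoid (Fin n → ℤ)) (hN : ∀ c : Fin n → ℤ, c ∈ N ↔ ∀ j, 0 ≤ c j) :
    N.FG ∧ N.NSMulSaturated ∧ Submodule.span ℤ (N : Set (Fin n → ℤ)) = ⊤ := by
  have hsingle : ∀ i, Pi.single i (1 : ℤ) ∈ N := by
    intro i
    rw [hN]
    intro j
    by_cases h : j = i
    · subst h; simp
    · simp [h]
  refine ⟨?_, ?_, span_eq_top_of_single_mem N hsingle⟩
  · rw [AddSubmonoid.fg_iff]
    refine ⟨Set.range fun i : Fin n => Pi.single i (1 : ℤ), le_antisymm ?_ ?_, Set.finite_range _⟩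
    · rw [AddSubmonoid.closure_le]
      rintro _ ⟨i, rfl⟩
      exact hsingle i
    · intro c hc
      exact mem_closure_of_forall_nonneg (Set.range fun i : Fin n => Pi.single i (1 : ℤ))
        (fun i => ⟨i, rfl⟩) c ((hN c).1 hc)
  · refine nsmulSaturated_of_linear N (Set.range fun i : Fin n => Pi.evalAddMonoidHom (fun _ => ℤ) i)
      fun c => ?_
    rw [hN]
    constructor
    · rintro h _ ⟨i, rfl⟩
      exact h i
    · intro h j
      exact h _ ⟨j, rfl⟩

end FreeMonoid

section Kummer

variable {p m : ℕ} {a : Fin (m + 1) → ℕ}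

/-- An integer inequality: if `p x + y ≥ 0` with `p > 0` then `x + ⌊y/p⌋ ≥ 0`. [folklore] -/
theorem add_ediv_nonneg_of_mul_add_nonneg {p : ℤ} (hp : 0 < p) {x y : ℤ}
    (h : 0 ≤ p * x + y) : 0 ≤ x + y / p := by
  have h1 : y % p + p * (y / p) = y := Int.emod_add_mul_ediv y p
  have h2 : y % p < p := Int.emod_lt_of_pos y hp
  by_contra hneg
  have h4 : x + y / p ≤ -1 := by omega
  have h5 : p * (x + y / p) ≤ p * (-1) := mul_le_mul_of_nonneg_left h4 hp.le
  nlinarith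

/-- The unit vectors lie in the Kummer monoid. [folklore] -/
theorem kummer_single_mem (P : AddSubmonoid (Fin (m + 1) → ℤ))
    (hP : ∀ c : Fin (m + 1) → ℤ, c ∈ P ↔
      0 ≤ c 0 ∧ ∀ i : Fin (m + 1), i ≠ 0 → 0 ≤ (a i : ℤ) * c 0 + (p : ℤ) * c i)
    (i : Fin (m + 1)) : Pi.single i (1 : ℤ) ∈ P := by
  rw [hP]
  by_cases hi : i = 0
  · subst hi
    refine ⟨by simp, fun i' hi' => ?_⟩
    rw [Pi.single_eq_same, Pi.single_eq_of_ne hi']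
    simp
  · refine ⟨by rw [Pi.single_eq_of_ne (Ne.symm hi)], fun i' _ => ?_⟩
    rw [Pi.single_eq_of_ne (Ne.symm hi), mul_zero, zero_add]
    by_cases h : i' = i
    · subst h; simp
    · rw [Pi.single_eq_of_ne h]; simp

/-- The Kummer monoid is saturated. [folklore] -/
theorem kummer_saturated (P : AddSubmonoid (Fin (m + 1) → ℤ))
    (hP : ∀ c : Fin (m + 1) → ℤ, c ∈ P ↔
      0 ≤ c 0 ∧ ∀ i : Fin (m + 1), i ≠ 0 → 0 ≤ (a i : ℤ) * c 0 + (p : ℤ) * c i) :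
    P.NSMulSaturated := by
  intro k c hkc
  rcases Nat.eq_zero_or_pos k with hk | hk
  · exact Or.inl hk
  · right
    have hk' : (0 : ℤ) < k := by exact_mod_cast hk
    obtain ⟨h0, h⟩ := (hP _).1 hkc
    simp only [Pi.smul_apply, nsmul_eq_mul] at h0 h
    refine (hP c).2 ⟨nonneg_of_mul_nonneg_right h0 hk', fun i hi => ?_⟩
    have h1 := h i hi
    have h2 : (a i : ℤ) * (k * c 0) + p * (k * c i) = k * ((a i : ℤ) * c 0 + p * c i) := by ring
    rw [h2] at h1
    exact nonneg_of_mul_nonneg_right h1 hk'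

/-- **Decomposition**: every element of the Kummer monoid is a non-negative combination of the
generators `v = (p, -a)`, `w_j = (j, -⌊j a/p⌋)` (`0 ≤ j < p`) and the unit vectors `e_i`.
[folklore] -/
theorem kummer_decompose (hp : 0 < p) (P : AddSubmonoid (Fin (m + 1) → ℤ))
    (hP : ∀ c : Fin (m + 1) → ℤ, c ∈ P ↔
      0 ≤ c 0 ∧ ∀ i : Fin (m + 1), i ≠ 0 → 0 ≤ (a i : ℤ) * c 0 + (p : ℤ) * c i)
    (c : Fin (m + 1) → ℤ) (hc : c ∈ P) :
    ∃ (q : ℕ) (j : ℤ) (e : Fin (m + 1) → ℕ), 0 ≤ j ∧ j < p ∧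
      c = q • (fun i : Fin (m + 1) => if i = 0 then (p : ℤ) else -(a i : ℤ)) +
        (fun i : Fin (m + 1) => if i = 0 then j else -(j * (a i : ℤ) / p)) +
        fun i => (e i : ℤ) := by
  obtain ⟨h0, h⟩ := (hP c).1 hc
  have hp' : (0 : ℤ) < p := by exact_mod_cast hp
  set q : ℤ := c 0 / p with hq
  set j : ℤ := c 0 % p with hj
  have hqj : j + (p : ℤ) * q = c 0 := Int.emod_add_mul_ediv (c 0) p
  have hj0 : 0 ≤ j := Int.emod_nonneg _ hp'.ne'
  have hjp : j < p := Int.emod_lt_of_pos _ hp'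
  have hq0 : 0 ≤ q := Int.ediv_nonneg h0 hp'.le
  -- the coefficients of the unit vectors
  have hn : ∀ i : Fin (m + 1), i ≠ 0 → 0 ≤ c i + q * (a i : ℤ) + j * (a i : ℤ) / p := by
    intro i hi
    have h1 := h i hi
    rw [← hqj] at h1
    have h2 : 0 ≤ (p : ℤ) * (c i + q * (a i : ℤ)) + j * (a i : ℤ) := by nlinarith [h1]
    have h3 := add_ediv_nonneg_of_mul_add_nonneg hp' h2
    linarith [h3]
  refine ⟨q.toNat, j, fun i => if i = 0 then 0 else (c i + q * (a i : ℤ) + j * (a i : ℤ) / p).toNat,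
    hj0, hjp, ?_⟩
  funext i
  rw [Pi.add_apply, Pi.add_apply, Pi.smul_apply, nsmul_eq_mul, Int.toNat_of_nonneg hq0]
  dsimp only
  by_cases hi : i = 0
  · subst hi
    rw [if_pos rfl, if_pos rfl, if_pos rfl, Nat.cast_zero, add_zero]
    linarith [hqj]
  · rw [if_neg hi, if_neg hi, if_neg hi, Int.toNat_of_nonneg (hn i hi)]
    ring

/-- **The Kummer monoid is finitely generated.** [folklore] -/
theorem kummer_fg (hp : 0 < p) (P : AddSubmonoid (Fin (m + 1) → ℤ))
    (hP : ∀ c : Fin (m + 1) → ℤ, c ∈ P ↔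
      0 ≤ c 0 ∧ ∀ i : Fin (m + 1), i ≠ 0 → 0 ≤ (a i : ℤ) * c 0 + (p : ℤ) * c i) : P.FG := by
  classical
  have hp' : (0 : ℤ) < p := by exact_mod_cast hp
  -- the generators
  let v : Fin (m + 1) → ℤ := fun i => if i = 0 then (p : ℤ) else -(a i : ℤ)
  let w : ℤ → Fin (m + 1) → ℤ := fun j i => if i = 0 then j else -(j * (a i : ℤ) / p)
  have hv : v ∈ P := by
    rw [hP]
    refine ⟨by simp [v], fun i hi => ?_⟩
    simp only [v, if_pos rfl, if_neg hi]
    linarith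
  have hw : ∀ j : ℤ, 0 ≤ j → w j ∈ P := by
    intro j hj
    rw [hP]
    refine ⟨by simpa [w] using hj, fun i hi => ?_⟩
    simp only [w, if_pos rfl, if_neg hi]
    have h1 : (p : ℤ) * (j * (a i : ℤ) / p) ≤ j * (a i : ℤ) := Int.mul_ediv_self_le hp'.ne'
    linarith
  have he := kummer_single_mem P hP
  let G : Set (Fin (m + 1) → ℤ) :=
    ({v} ∪ Set.range fun j : Fin p => w ((j : ℕ) : ℤ)) ∪ Set.range fun i : Fin (m + 1) => Pi.single i (1 : ℤ)
  rw [AddSubmonoid.fg_iff]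
  refine ⟨G, le_antisymm ?_ ?_, ?_⟩
  · rw [AddSubmonoid.closure_le]
    rintro x ((hx | ⟨j, rfl⟩) | ⟨i, rfl⟩)
    · rw [Set.mem_singleton_iff] at hx
      rw [hx]
      exact hv
    · exact hw _ (by positivity)
    · exact he i
  · intro c hc
    obtain ⟨q, j, e, hj0, hjp, hcd⟩ := kummer_decompose hp P hP c hc
    have hvG : v ∈ G := Or.inl (Or.inl rfl)
    have h1 : q • v ∈ AddSubmonoid.closure G :=
      AddSubmonoid.nsmul_mem _ (AddSubmonoid.subset_closure hvG) _
    have hjn : j.toNat < p := by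
      have := (Int.toNat_lt hj0).2 hjp
      exact_mod_cast this
    have hwj : w j = w (((⟨j.toNat, hjn⟩ : Fin p) : ℕ) : ℤ) := by
      simp only [Int.toNat_of_nonneg hj0]
    have h2 : w j ∈ AddSubmonoid.closure G := by
      rw [hwj]
      exact AddSubmonoid.subset_closure (Or.inl (Or.inr ⟨⟨j.toNat, hjn⟩, rfl⟩))
    have h3 : (fun i => (e i : ℤ)) ∈ AddSubmonoid.closure G :=
      mem_closure_of_forall_nonneg G (fun i => Or.inr ⟨i, rfl⟩) _ fun i => by positivity
    rw [hcd]
    exact add_mem (add_mem h1 h2) h3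
  · exact ((Set.finite_singleton _).union (Set.finite_range _)).union (Set.finite_range _)

/-- **The Kummer monoid is finitely generated, saturated and spanning.** [folklore] -/
theorem kummer_fs (hp : 0 < p) (P : AddSubmonoid (Fin (m + 1) → ℤ))
    (hP : ∀ c : Fin (m + 1) → ℤ, c ∈ P ↔
      0 ≤ c 0 ∧ ∀ i : Fin (m + 1), i ≠ 0 → 0 ≤ (a i : ℤ) * c 0 + (p : ℤ) * c i) :
    P.FG ∧ P.NSMulSaturated ∧ Submodule.span ℤ (P : Set (Fin (m + 1) → ℤ)) = ⊤ :=
  ⟨kummer_fg hp P hP, kummer_saturated P hP, span_eq_top_of_single_mem P (kummer_single_mem P hP)⟩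

end Kummer

/-- **Registered stub `stub_kummerMonoid`**: for a prime `p` and exponents `a`, the Kummer monoid
`P = {c ∈ ℤ^{m+1} | 0 ≤ c₀, 0 ≤ a_i c₀ + p c_i (i ≠ 0)}`, its product `P × ℕ^{r'} ⊆ ℤ^{(m+1)+r'}`
with a free monoid, and the free monoid `ℕ^{r'} ⊆ ℤ^{r'}` exist as additive submonoids with these
membership predicates and are finitely generated, saturated and span the ambient lattice.
[folklore] -/
theorem stub_kummerMonoid (p : ℕ) (hp : p.Prime) (m : ℕ) (a : Fin (m + 1) → ℕ) (r' : ℕ) :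
    (∃ (P : AddSubmonoid (Fin (m + 1) → ℤ)) (P' : AddSubmonoid (Fin ((m + 1) + r') → ℤ)),
      (∀ c : Fin (m + 1) → ℤ, c ∈ P ↔
        0 ≤ c 0 ∧ ∀ i : Fin (m + 1), i ≠ 0 → 0 ≤ (a i : ℤ) * c 0 + (p : ℤ) * c i) ∧
      P.FG ∧ P.NSMulSaturated ∧ Submodule.span ℤ (P : Set (Fin (m + 1) → ℤ)) = ⊤ ∧
      (∀ c : Fin ((m + 1) + r') → ℤ, c ∈ P' ↔
        (fun i : Fin (m + 1) => c (Fin.castAdd r' i)) ∈ P ∧ ∀ j : Fin r', 0 ≤ c (Fin.natAdd (m + 1) j)) ∧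
      P'.FG ∧ P'.NSMulSaturated ∧ Submodule.span ℤ (P' : Set (Fin ((m + 1) + r') → ℤ)) = ⊤) ∧
    ∃ N : AddSubmonoid (Fin r' → ℤ), (∀ c : Fin r' → ℤ, c ∈ N ↔ ∀ j, 0 ≤ c j) ∧
      N.FG ∧ N.NSMulSaturated ∧ Submodule.span ℤ (N : Set (Fin r' → ℤ)) = ⊤ := by
  -- the three submonoids, by their carriers
  let P : AddSubmonoid (Fin (m + 1) → ℤ) :=
    { carrier := {c | 0 ≤ c 0 ∧ ∀ i : Fin (m + 1), i ≠ 0 → 0 ≤ (a i : ℤ) * c 0 + (p : ℤ) * c i}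
      zero_mem' := ⟨le_rfl, fun i _ => by simp⟩
      add_mem' := by
        rintro c c' ⟨h0, h⟩ ⟨h0', h'⟩
        refine ⟨add_nonneg h0 h0', fun i hi => ?_⟩
        have h1 := add_nonneg (h i hi) (h' i hi)
        simp only [Pi.add_apply]
        linarith }
  have hP : ∀ c : Fin (m + 1) → ℤ, c ∈ P ↔
      0 ≤ c 0 ∧ ∀ i : Fin (m + 1), i ≠ 0 → 0 ≤ (a i : ℤ) * c 0 + (p : ℤ) * c i := fun c => Iff.rfl
  let P' : AddSubmonoid (Fin ((m + 1) + r') → ℤ) :=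
    { carrier := {c | (fun i : Fin (m + 1) => c (Fin.castAdd r' i)) ∈ P ∧
        ∀ j : Fin r', 0 ≤ c (Fin.natAdd (m + 1) j)}
      zero_mem' := ⟨(zero_mem P : (0 : Fin (m + 1) → ℤ) ∈ P), fun j => le_rfl⟩
      add_mem' := by
        rintro c c' ⟨h, hn⟩ ⟨h', hn'⟩
        refine ⟨?_, fun j => add_nonneg (hn j) (hn' j)⟩
        have h1 : (fun i : Fin (m + 1) => (c + c') (Fin.castAdd r' i)) =
            (fun i => c (Fin.castAdd r' i)) + fun i => c' (Fin.castAdd r' i) := rfl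
        rw [h1]
        exact add_mem h h' }
  have hP' : ∀ c : Fin ((m + 1) + r') → ℤ, c ∈ P' ↔
      (fun i : Fin (m + 1) => c (Fin.castAdd r' i)) ∈ P ∧ ∀ j : Fin r', 0 ≤ c (Fin.natAdd (m + 1) j) :=
    fun c => Iff.rfl
  let N : AddSubmonoid (Fin r' → ℤ) :=
    { carrier := {c | ∀ j, 0 ≤ c j}
      zero_mem' := fun j => le_rfl
      add_mem' := fun h h' j => add_nonneg (h j) (h' j) }
  have hN : ∀ c : Fin r' → ℤ, c ∈ N ↔ ∀ j, 0 ≤ c j := fun c => Iff.rfl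
  obtain ⟨hfg, hsat, hspan⟩ := kummer_fs hp.pos P hP
  exact ⟨⟨P, P', hP, hfg, hsat, hspan, hP', stub_prodFreeMonoid P hfg hsat (kummer_single_mem P hP) P' hP'⟩,
    N, hN, freeMonoid_fs N hN⟩

end Summit.ResolutionOfSingularities.ResolutionOfSingularities.Theorems.RadicialJung.CleanModelsSuffice
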